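import Mathlib
import HarnessLib
import Summits.MatrixMultiplication.MatrixMultiplication.Theorems.FarEdgeDescentNarrownessPotential
import Summits.MatrixMultiplication.MatrixMultiplication.Theorems.FarEdgeDescentFloorNarrowness
import Summits.MatrixMultiplication.MatrixMultiplication.Theorems.FarEdgeDescentTreeCapTools

/-!
# Far-edge descent, kernel XLIII — why the floor dial degenerates at the cost-free budget `β = 2` (model level)

The β-uniform programme (memo g62 §5, g63) certifies, slab by slab, the region criterion
`RegionCriterion β z ε Vmin κ_S` of kernel XLII-C and hence the schedule cap XL-D(a, β) for every
dial `β` of the slab; the certified margins shrink to `0` as `β → 2⁻` (≈ 1.1e-4 at `199/100`) and no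
certificate is claimed at `β = 2`.  THIS FILE types the reason, in four exact statements.

* `Vfloor_two_eq_zero`: at `β = 2` every floor weight `τ'_j = min(1, β/(2 − a^{-j}))` equals `1`, so
  the truncated floor minimum `Vfloor a 2 z m` is `0` identically; and `Vfloor_le_one_sub_half`:
  `Vfloor a β z m ≤ 1 − β/2` for `0 ≤ β ≤ 2`, `z ∈ [0,1]` — the narrowness floor vanishes (at least)
  linearly at the cost-free budget.
* `half_rpow_le_of_regionCriterion`: for `1 ≤ β`, `−1 < ε` and a floor level `Vmin ≤ 0`, the
  region criterion at exponent `κ` forces `(1/2)^κ ≤ (2β−1)/(2β)`: instantiate it at the DEEP FIXED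
  POINT `λ = λ' = 1/(2β−1)` (pinning-exact, wedge-free), zero narrowness, `x = 1/2`.
* `not_regionCriterion_kappaS_of_floor_nonpos`: hence for `β < 2` the criterion at Strassen's exponent
  `κ_S = log(4/3)/log 2` FAILS whenever the floor level is `≤ 0` — below the cost-free budget the
  fixed-point deficit `(3/2)·β/(2β−1) − 1 = (2−β)/(2(2β−1)) > 0` (`fixedPoint_gap`) is paid ONLY by the
  narrowness floor, which is exactly the quantity that vanishes as `β → 2`.
* `kappaS_le_of_regionCriterion_two` and `regionCriterion_two_tight`: AT `β = 2` (floor `0`) no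
  exponent `κ < κ_S` satisfies the criterion, and at `κ_S` the pair inequality is an EQUALITY at
  `(λ, λ', V, V', x) = (1/3, 1/3, 0, 0, 1/2)` since `2·(1/2)^{κ_S} = 3/2` is the definition of `κ_S` —
  the model-level twin of the exact ceiling of kernel XXXVII: the cost-free dial is capped AT, never
  below, Strassen's exponent, with zero margin, so fixed-`(z, ε)` vertex certificates (inexact tangent
  majorants) cannot reach it.

HONEST FRAMING: MODEL level (statements about the real inequality `RegionCriterion` and the numbers
`tauP`, `Vfloor`); no `sorry`, no new axioms, no new definitions.  Nothing here touches
`_root_.MatrixMultiplication` or the `closes` cut of `Theses/FarEdgeDescent.lean`; helper for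
FiniteSaturation (stmt 23739) in the sense of the dial programme only.  References: kernels XLII-C/D
(`FarEdgeDescentNarrownessPotential`, `FarEdgeDescentFloorNarrowness`), XXXVII
(`FarEdgeDescentExactCeiling`); Schönhage 1981 [Schonhage1981]; memo g62/g63.
-/

noncomputable section

set_option linter.dupNamespace false

namespace Summit.MatrixMultiplication.MatrixMultiplication.Theorems.FarEdgeDescentDialDegeneration

open Finset
open Summit.MatrixMultiplication.MatrixMultiplication.Theorems.FarEdgeDescentNarrownessPotential
open Summit.MatrixMultiplication.MatrixMultiplication.Theorems.FarEdgeDescentFloorNarrowness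
open Summit.MatrixMultiplication.MatrixMultiplication.Theorems.FarEdgeDescentTreeCapTools

/-! ## The floor vanishes at `β = 2` -/

/-- At the cost-free budget every floor weight is `1`. -/
theorem tauP_two {a : ℝ} (ha : 1 ≤ a) (j : ℕ) : tauP a 2 j = 1 := by
  have ha0 : 0 < a := by linarith
  have hi0 : 0 ≤ a⁻¹ := inv_nonneg.mpr ha0.le
  have hi1 : a⁻¹ ≤ 1 := inv_le_one_of_one_le₀ ha
  have hp0 : 0 ≤ a⁻¹ ^ j := pow_nonneg hi0 j
  have hp1 : a⁻¹ ^ j ≤ 1 := pow_le_one₀ hi0 hi1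
  have hD : 0 < 2 - a⁻¹ ^ j := by linarith
  unfold tauP
  apply min_eq_left
  rw [le_div_iff₀ hD]
  linarith

/-- **The narrowness floor vanishes at the cost-free budget**: `Vfloor a 2 z m = 0`. -/
theorem Vfloor_two_eq_zero {a : ℝ} (ha : 1 ≤ a) (z : ℝ) (m : ℕ) : Vfloor a 2 z m = 0 := by
  unfold Vfloor
  simp only [tauP_two ha, one_mul]
  have h := geom_sum_mul_neg z m
  -- (Σ_{k<m} z^k) * (1 - z) = 1 - z^m
  nlinarith [h]

/-- Every floor weight is at least `β/2` (`0 ≤ β ≤ 2`). -/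
theorem half_beta_le_tauP {a β : ℝ} (ha : 1 ≤ a) (hβ0 : 0 ≤ β) (hβ2 : β ≤ 2) (j : ℕ) :
    β / 2 ≤ tauP a β j := by
  have ha0 : 0 < a := by linarith
  have hi0 : 0 ≤ a⁻¹ := inv_nonneg.mpr ha0.le
  have hi1 : a⁻¹ ≤ 1 := inv_le_one_of_one_le₀ ha
  have hp0 : 0 ≤ a⁻¹ ^ j := pow_nonneg hi0 j
  have hp1 : a⁻¹ ^ j ≤ 1 := pow_le_one₀ hi0 hi1
  have hD : 0 < 2 - a⁻¹ ^ j := by linarith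
  unfold tauP
  refine le_min (by linarith) ?_
  exact div_le_div_of_nonneg_left hβ0 hD (by linarith)

/-- **The floor vanishes at least linearly at `β = 2`**: `Vfloor a β z m ≤ 1 − β/2`. -/
theorem Vfloor_le_one_sub_half {a β z : ℝ} (ha : 1 ≤ a) (hβ0 : 0 ≤ β) (hβ2 : β ≤ 2)
    (hz0 : 0 ≤ z) (hz1 : z ≤ 1) (m : ℕ) : Vfloor a β z m ≤ 1 - β / 2 := by
  unfold Vfloor
  have hS : (1 - z) * ∑ k ∈ range m, β / 2 * z ^ k ≤ (1 - z) * ∑ k ∈ range m, tauP a β (k + 2) * z ^ k := by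
    apply mul_le_mul_of_nonneg_left _ (by linarith)
    apply sum_le_sum
    intro k _
    exact mul_le_mul_of_nonneg_right (half_beta_le_tauP ha hβ0 hβ2 (k + 2)) (pow_nonneg hz0 k)
  have hT : β / 2 * z ^ m ≤ tauP a β (m + 2) * z ^ m :=
    mul_le_mul_of_nonneg_right (half_beta_le_tauP ha hβ0 hβ2 (m + 2)) (pow_nonneg hz0 m)
  have hg := geom_sum_mul_neg z m
  have hE : (1 - z) * ∑ k ∈ range m, β / 2 * z ^ k = β / 2 * (1 - z ^ m) := by
    rw [← mul_sum, ← hg]; ring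
  linarith [hS, hT, hE]

/-! ## The deep fixed point -/

/-- **The region criterion, read at the deep fixed point.**  For `1 ≤ β ≤ 2`, `−1 < ε` and a floor
level `Vmin ≤ 0` (any `β ≥ 1`), `RegionCriterion β z ε Vmin κ` forces `(1/2)^κ ≤ (2β−1)/(2β)`:
instantiate it at `λ = λ' = 1/(2β−1)`, `V = V' = V_P = 0`, `x = 1/2`. -/
theorem half_rpow_le_of_regionCriterion {β z ε Vmin κ : ℝ} (hβ1 : 1 ≤ β)
    (hε : -1 < ε) (hV : Vmin ≤ 0) (h : RegionCriterion β z ε Vmin κ) :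
    (1 / 2 : ℝ) ^ κ ≤ (2 * β - 1) / (2 * β) := by
  have hg : 0 < 2 * β - 1 := by linarith
  obtain ⟨lam, hlam⟩ : ∃ lam : ℝ, lam = 1 / (2 * β - 1) := ⟨_, rfl⟩
  have hlam0 : 0 < lam := by rw [hlam]; positivity
  have hglam : (2 * β - 1) * lam = 1 := by rw [hlam]; field_simp
  have hblam : β * lam ≤ 1 := by
    have : 0 ≤ (β - 1) * lam := mul_nonneg (by linarith) hlam0.le
    linarith [hglam]
  have hwedge : β * ((2 * β - 1) * lam - 1) ≤ (β - 1) * 0 := by rw [hglam]; simp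
  have hpin : |1 - (2 * β - 1) * lam| ≤ (0 : ℝ) ^ 2 := by rw [hglam]; simp
  have hP : (0 : ℝ) * (lam + lam - (2 * β - 1) * lam * lam) =
      lam * (1 - β * lam) * 0 + lam * (1 - β * lam) * 0 + z * lam * lam * 0 * 0 := by ring
  have key := h lam lam 0 0 0 hlam0 hblam hlam0 hblam hV zero_le_one hV zero_le_one hwedge hwedge
    hpin hpin hP hV (1 / 2) (by norm_num) (by norm_num)
  have hhalf : (1 - 1 / 2 : ℝ) = 1 / 2 := by norm_num
  rw [hhalf] at key
  simp only [sub_zero] at key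
  have hu : 1 - (β - 1) * lam = β * lam := by linear_combination (-1 : ℝ) * hglam
  have hS : lam + lam - (2 * β - 1) * lam * lam = lam := by linear_combination (-lam) * hglam
  rw [hu, hS] at key
  have hε1 : 0 < ε + 1 := by linarith
  have k2 : 2 * β * lam * (1 / 2 : ℝ) ^ κ ≤ 1 := by
    have e : β * lam * (lam * (ε + 1)) * (1 / 2 : ℝ) ^ κ + β * lam * (lam * (ε + 1)) * (1 / 2 : ℝ) ^ κ =
        lam * (ε + 1) * (2 * β * lam * (1 / 2 : ℝ) ^ κ) := by ring
    have hpos : 0 < lam * (ε + 1) := by positivity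
    rw [e] at key
    have key' : lam * (ε + 1) * (2 * β * lam * (1 / 2 : ℝ) ^ κ) ≤ lam * (ε + 1) * 1 := by linarith
    exact le_of_mul_le_mul_left key' hpos
  have hβ0 : 0 < β := by linarith
  rw [le_div_iff₀ (by positivity)]
  have e2 : (1 / 2 : ℝ) ^ κ * (2 * β) = 2 * β * lam * (1 / 2 : ℝ) ^ κ * (2 * β - 1) := by
    linear_combination (-(2 * β) * (1 / 2 : ℝ) ^ κ) * hglam
  rw [e2]
  nlinarith [mul_nonneg (sub_nonneg.mpr k2) hg.le]

/-- **Below the cost-free budget the narrowness floor is NECESSARY.**  For `1 ≤ β < 2` and any floor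
level `Vmin ≤ 0` the region criterion at Strassen's exponent `κ_S` fails (at the deep fixed point the
deficit `(3/2)·β/(2β−1) − 1 = (2−β)/(2(2β−1))` is positive and nothing but narrowness pays it). -/
theorem not_regionCriterion_kappaS_of_floor_nonpos {β z ε Vmin : ℝ} (hβ1 : 1 ≤ β) (hβ2 : β < 2)
    (hε : -1 < ε) (hV : Vmin ≤ 0) :
    ¬ RegionCriterion β z ε Vmin (Real.log (4 / 3) / Real.log 2) := by
  intro h
  have key := half_rpow_le_of_regionCriterion hβ1 hε hV h
  rw [half_rpow_kappaS, le_div_iff₀ (by linarith)] at key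
  linarith

/-- More precisely: with floor level `≤ 0`, an exponent certified by the region criterion at a budget
`β < 2` is STRICTLY above Strassen's: `κ_S < κ`. -/
theorem kappaS_lt_of_regionCriterion_floor_nonpos {β z ε Vmin κ : ℝ} (hβ1 : 1 ≤ β) (hβ2 : β < 2)
    (hε : -1 < ε) (hV : Vmin ≤ 0) (h : RegionCriterion β z ε Vmin κ) :
    Real.log (4 / 3) / Real.log 2 < κ := by
  have key := half_rpow_le_of_regionCriterion hβ1 hε hV h
  have hlt : (2 * β - 1) / (2 * β) < 3 / 4 := by
    rw [div_lt_iff₀ (by linarith)]; linarith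
  have : (1 / 2 : ℝ) ^ κ < (1 / 2 : ℝ) ^ (Real.log (4 / 3) / Real.log 2) := by
    rw [half_rpow_kappaS]; linarith
  exact (Real.rpow_lt_rpow_left_iff_of_base_lt_one (by norm_num) (by norm_num)).mp this

/-! ## At `β = 2`: capped at, never below, Strassen's exponent -/

/-- **At the cost-free budget no exponent below `κ_S` satisfies the region criterion** (floor `≤ 0`,
which by `Vfloor_two_eq_zero` is all the floor transfer provides there). -/
theorem kappaS_le_of_regionCriterion_two {z ε Vmin κ : ℝ} (hε : -1 < ε) (hV : Vmin ≤ 0)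
    (h : RegionCriterion 2 z ε Vmin κ) : Real.log (4 / 3) / Real.log 2 ≤ κ := by
  have key := half_rpow_le_of_regionCriterion (β := 2) (by norm_num) hε hV h
  have h34 : ((2 : ℝ) * 2 - 1) / (2 * 2) = 3 / 4 := by norm_num
  rw [h34, ← half_rpow_kappaS] at key
  exact (Real.rpow_le_rpow_left_iff_of_base_lt_one (by norm_num) (by norm_num)).mp key

/-- The deep fixed point of the cost-free dial, `(λ, λ', V, V', V_P) = (1/3, 1/3, 0, 0, 0)`, satisfies
every hypothesis of `RegionCriterion 2 z ε Vmin κ` as soon as `Vmin ≤ 0`. -/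
theorem fixedPoint_two_admissible (z Vmin : ℝ) (hV : Vmin ≤ 0) :
    (0 : ℝ) < 1 / 3 ∧ (2 : ℝ) * (1 / 3) ≤ 1 ∧ Vmin ≤ 0 ∧ (0 : ℝ) ≤ 1 ∧
      (2 : ℝ) * ((2 * 2 - 1) * (1 / 3) - 1) ≤ (2 - 1) * 0 ∧ |1 - (2 * (2 : ℝ) - 1) * (1 / 3)| ≤ (0 : ℝ) ^ 2 ∧
      (0 : ℝ) * (1 / 3 + 1 / 3 - (2 * 2 - 1) * (1 / 3) * (1 / 3)) =
        1 / 3 * (1 - 2 * (1 / 3)) * 0 + 1 / 3 * (1 - 2 * (1 / 3)) * 0 + z * (1 / 3) * (1 / 3) * 0 * 0 ∧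
      Vmin ≤ 0 := by
  refine ⟨by norm_num, by norm_num, hV, by norm_num, by norm_num, by norm_num, by ring, hV⟩

/-- **Tightness at `β = 2`.**  At that point and `x = 1/2` the pair inequality of
`RegionCriterion 2 z ε Vmin κ_S` is an EQUALITY (`2·(1/2)^{κ_S} = 3/2` is the definition of `κ_S`):
the cost-free dial is capped at Strassen's exponent with ZERO margin. -/
theorem regionCriterion_two_tight (ε : ℝ) :
    (1 - (2 - 1) * (1 / 3 : ℝ)) * (1 / 3 * (ε + 1 - 0)) * (1 / 2 : ℝ) ^ (Real.log (4 / 3) / Real.log 2) +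
        (1 - (2 - 1) * (1 / 3 : ℝ)) * (1 / 3 * (ε + 1 - 0)) *
          (1 - 1 / 2 : ℝ) ^ (Real.log (4 / 3) / Real.log 2) =
      (1 / 3 + 1 / 3 - (2 * 2 - 1) * (1 / 3) * (1 / 3 : ℝ)) * (ε + 1 - 0) := by
  have hhalf : (1 - 1 / 2 : ℝ) = 1 / 2 := by norm_num
  rw [hhalf, half_rpow_kappaS]
  ring

/-- **The fixed-point gap below `β = 2`** (for the record): at `λ = λ' = 1/(2β−1)`, zero narrowness,
`V_P = 0`, `x = 1/2`, the pair inequality's `LHS − RHS` at `κ_S` equals `(ε+1)(2−β)/(2(2β−1)²)` —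
positive for every `β < 2`, zero at `β = 2`. -/
theorem fixedPoint_gap {β ε : ℝ} (hβ : 2 * β - 1 ≠ 0) :
    (1 - (β - 1) * (1 / (2 * β - 1))) * (1 / (2 * β - 1) * (ε + 1 - 0)) *
          (1 / 2 : ℝ) ^ (Real.log (4 / 3) / Real.log 2) +
        (1 - (β - 1) * (1 / (2 * β - 1))) * (1 / (2 * β - 1) * (ε + 1 - 0)) *
          (1 - 1 / 2 : ℝ) ^ (Real.log (4 / 3) / Real.log 2) -
      (1 / (2 * β - 1) + 1 / (2 * β - 1) - (2 * β - 1) * (1 / (2 * β - 1)) * (1 / (2 * β - 1))) *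
        (ε + 1 - 0) =
      (ε + 1) * (2 - β) / (2 * (2 * β - 1) ^ 2) := by
  have hhalf : (1 - 1 / 2 : ℝ) = 1 / 2 := by norm_num
  rw [hhalf, half_rpow_kappaS]
  obtain ⟨g, hg⟩ : ∃ g : ℝ, g = 2 * β - 1 := ⟨_, rfl⟩
  have hβg : β = (g + 1) / 2 := by rw [hg]; ring
  rw [← hg] at hβ ⊢
  rw [hβg]
  field_simp
  ring

end Summit.MatrixMultiplication.MatrixMultiplication.Theorems.FarEdgeDescentDialDegeneration
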